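import Mathlib
import HarnessLib

/-!
# Explicit trace-one elements in Kummer extensions of degree `p`
# (toward Tate's almost étale lemma, Tate 1967 §3.2 Prop. 9 / Berger–Colmez (TS1))

Let `L/K` be a field extension of degree `p` generated by `α` with `α ^ p = a ∈ K`, `a ≠ 1`
(a Kummer extension when `μ_p ⊆ K`). This file records the EXPLICIT algebra behind the degree-`p`
step of an elementary proof of Tate's almost étale lemma (Tate 1967, §3.2 Prop. 9: for finite
extensions `L ⊇ M ⊇ K_∞ = K(μ_{p^∞})`, `Tr_{L/M}(𝓞_L) ⊇ 𝔪_M`; Berger–Colmez 2008 Déf. 3.1.3 (TS1),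
Prop. 4.1.1), namely:

* `KummerTrace.minpoly_inv_gen_sub_one` : the minimal polynomial of `x = (α - 1)⁻¹` over `K` is
  `X^p - (a-1)⁻¹((X+1)^p - X^p)` (from `(x + 1)^p = (α x)^p = a x^p`);
* `KummerTrace.trace_inv_gen_sub_one` : **`Tr_{L/K}((α - 1)⁻¹) = p / (a - 1)`**;
* `KummerTrace.trace_gen_div_gen_sub_one` : `Tr_{L/K}(α/(α - 1)) = p a / (a - 1)`;
* `KummerTrace.trace_traceOneElt` : the element `y = ((a-1)/(p a)) · α/(α-1)` has **`Tr_{L/K}(y) = 1`**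
  (when `p ≠ 0` in `K`, `a ≠ 0`);

and, in an ultrametric normed field, the size of that element when `a = 1 + t` is a unit close to `1`:

* `KummerTrace.norm_pow_sub_one_le` : `‖α^p - 1‖ ≤ max (‖α-1‖^p) (‖p‖ ‖α-1‖)` for `‖α - 1‖ ≤ 1`;
* `KummerTrace.norm_traceOneElt_le` : `‖((a-1)/(p a)) α/(α-1)‖ ≤ max 1 (‖a-1‖^((p-1)/p) / ‖p‖)`
  for `‖α‖ = 1 = ‖a‖`: so if `‖a - 1‖ ≤ ‖p‖^σ` with `σ` close to `p/(p-1)` the trace-one element is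
  ALMOST INTEGRAL (`‖y‖ ≤ ‖p‖^(σ(p-1)/p - 1)`, exponent `→ 0`).

These are the two halves of the "Kummer step": in a field `M ⊇ K_∞` in which every unit is a `p`-th
power up to `p^{1-ε}` and the value group is `p`-divisible, a Kummer generator `a` can be renormalised
(`a ↦ a b^p`) to depth `σ → p/(p-1)` (file `KummerDepth`), and then `y` witnesses `Tr(𝓞_L) ∋` elements
of valuation `→ 0`. Own elementary argument (no differents, no ramification filtration); the statement
it serves is Tate's. Pure algebra here: no `sorry`, no definitions.

References: J. Tate, *p-divisible groups* (1967) §3.2 Prop. 9 [Tate1967]; L. Berger, P. Colmez,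
*Familles de représentations de de Rham et monodromie p-adique*, Astérisque 319 (2008), Déf. 3.1.3,
Prop. 4.1.1 [BergerColmez2008]; S. Lang, *Algebra*, Prop. VI.5.? (Euler's dual basis `b_i/f'(x)`),
of which `y = b₀/g'(α-1)` for `g(X) = (X+1)^p - a` is the instance used here [folklore].
-/

noncomputable section

open Polynomial IntermediateField Module

namespace Literature.NumberTheory.PAdicHodge

namespace KummerTrace

variable {K L : Type*} [Field K] [Field L] [Algebra K L]

/-! ### The minimal polynomial of `(α - 1)⁻¹` -/

/-- `deg((X+1)^p - X^p) < p`. [folklore] -/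
private theorem degree_X_add_one_pow_sub_X_pow_lt (K : Type*) [Field K] (p : ℕ) :
    ((X + 1 : K[X]) ^ p - X ^ p).degree < (p : WithBot ℕ) := by
  have hm : ((X + 1 : K[X]) ^ p).Monic := by
    simpa using (monic_X_add_C (1 : K)).pow p
  have h1 : ((X + 1 : K[X]) ^ p).degree = p := by
    rw [degree_eq_natDegree hm.ne_zero, natDegree_pow, ← C_1, natDegree_X_add_C, mul_one]
  have h2 : ((X : K[X]) ^ p).degree = p := by rw [degree_X_pow]
  calc ((X + 1 : K[X]) ^ p - X ^ p).degree < ((X + 1 : K[X]) ^ p).degree := by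
        refine degree_sub_lt (h1.trans h2.symm) hm.ne_zero ?_
        rw [Monic.leadingCoeff (monic_X_pow p), hm.leadingCoeff]
    _ = p := h1

/-- `deg((a-1)⁻¹ · ((X+1)^p - X^p)) < p = deg X^p`. [folklore] -/
private theorem degree_C_mul_lt (p : ℕ) (a : K) :
    (C (a - 1)⁻¹ * ((X + 1 : K[X]) ^ p - X ^ p)).degree < ((X : K[X]) ^ p).degree := by
  rw [degree_X_pow]
  refine (degree_mul_le _ _).trans_lt ?_
  calc (C (a - 1)⁻¹).degree + ((X + 1 : K[X]) ^ p - X ^ p).degree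
      ≤ 0 + ((X + 1 : K[X]) ^ p - X ^ p).degree := by gcongr; exact degree_C_le
    _ < p := by rw [zero_add]; exact degree_X_add_one_pow_sub_X_pow_lt K p

/-- `q_a` is monic. [folklore] -/
private theorem monic_invGenPoly (p : ℕ) (a : K) :
    (X ^ p - C (a - 1)⁻¹ * ((X + 1) ^ p - X ^ p) : K[X]).Monic :=
  (monic_X_pow p).sub_of_left (degree_C_mul_lt p a)

/-- `degree q_a = p`. [folklore] -/
private theorem degree_invGenPoly (p : ℕ) (a : K) :
    (X ^ p - C (a - 1)⁻¹ * ((X + 1) ^ p - X ^ p) : K[X]).degree = p := by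
  rw [degree_sub_eq_left_of_degree_lt (degree_C_mul_lt p a), degree_X_pow]

/-- `deg q_a = p`. [folklore] -/
private theorem natDegree_invGenPoly (p : ℕ) (a : K) :
    (X ^ p - C (a - 1)⁻¹ * ((X + 1) ^ p - X ^ p) : K[X]).natDegree = p :=
  natDegree_eq_of_degree_eq_some (degree_invGenPoly p a)

/-- The next coefficient of `q_a` is `-(a-1)⁻¹ · p` (the coefficient of `X^{p-1}` in `(X+1)^p` is
`C(p, p-1) = p`). [folklore] -/
private theorem nextCoeff_invGenPoly {p : ℕ} (hp : 0 < p) (a : K) :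
    (X ^ p - C (a - 1)⁻¹ * ((X + 1) ^ p - X ^ p) : K[X]).nextCoeff = -((a - 1)⁻¹ * p) := by
  rw [nextCoeff_of_natDegree_pos (by rw [natDegree_invGenPoly p a]; exact hp),
    natDegree_invGenPoly p a]
  have hne : p - 1 ≠ p := by omega
  rw [coeff_sub, coeff_X_pow, if_neg hne, coeff_C_mul, coeff_sub, coeff_X_pow, if_neg hne,
    coeff_X_add_one_pow, sub_zero, zero_sub, Nat.choose_symm_of_eq_add (Nat.sub_add_cancel hp).symm,
    Nat.choose_one_right]

/-- For `α ^ p = a ≠ 1` (so `α ≠ 1`): `x = (α - 1)⁻¹` satisfies `x + 1 = α x`. [folklore] -/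
private theorem inv_sub_one_add_one {p : ℕ} {α : L} {a : K} (hα : α ^ p = algebraMap K L a) (ha : a ≠ 1) :
    (α - 1)⁻¹ + 1 = α * (α - 1)⁻¹ := by
  have h1 : α - 1 ≠ 0 := by
    intro h
    have : α = 1 := sub_eq_zero.mp h
    rw [this, one_pow, eq_comm, map_eq_one_iff _ (algebraMap K L).injective] at hα
    exact ha hα
  field_simp
  ring

/-- `x = (α - 1)⁻¹` is a root of `q_a` when `α ^ p = a ≠ 1`: `(x+1)^p = (α x)^p = a x^p`. [folklore] -/
private theorem aeval_invGenPoly {p : ℕ} {α : L} {a : K} (hα : α ^ p = algebraMap K L a) (ha : a ≠ 1) :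
    aeval (α - 1)⁻¹ (X ^ p - C (a - 1)⁻¹ * ((X + 1) ^ p - X ^ p) : K[X]) = 0 := by
  have hx : ((α - 1)⁻¹ + 1) ^ p = algebraMap K L a * ((α - 1)⁻¹) ^ p := by
    rw [inv_sub_one_add_one hα ha, mul_pow, hα]
  have ha' : algebraMap K L a - 1 ≠ 0 := by
    rw [sub_ne_zero, Ne, map_eq_one_iff _ (algebraMap K L).injective]; exact ha
  simp only [map_sub, map_mul, aeval_C, map_pow, aeval_X, map_add, map_one, map_inv₀]
  rw [hx]
  field_simp
  ring

/-- If `α` generates `L/K` then so does `(α - 1)⁻¹` (for `α ≠ 1`, i.e. `α ^ p = a ≠ 1`). [folklore] -/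
private theorem adjoin_inv_sub_one_eq_top {p : ℕ} {α : L} {a : K} (hα : α ^ p = algebraMap K L a)
    (ha : a ≠ 1) (hgen : K⟮α⟯ = ⊤) : K⟮(α - 1)⁻¹⟯ = ⊤ := by
  have h1 : α - 1 ≠ 0 := by
    intro h
    have : α = 1 := sub_eq_zero.mp h
    rw [this, one_pow, eq_comm, map_eq_one_iff _ (algebraMap K L).injective] at hα
    exact ha hα
  rw [eq_top_iff, ← hgen, adjoin_simple_le_iff]
  have hx : (α - 1)⁻¹ ∈ K⟮(α - 1)⁻¹⟯ := mem_adjoin_simple_self K _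
  have hmem : ((α - 1)⁻¹)⁻¹ + 1 ∈ K⟮(α - 1)⁻¹⟯ := add_mem (inv_mem hx) (one_mem _)
  have : ((α - 1)⁻¹)⁻¹ + 1 = α := by rw [inv_inv]; ring
  rwa [this] at hmem

variable [FiniteDimensional K L]

/-- **The minimal polynomial of `(α - 1)⁻¹`.** If `[L : K] = p`, `L = K(α)`, `α ^ p = a ≠ 1`, then
`minpoly K (α - 1)⁻¹ = X^p - (a-1)⁻¹((X+1)^p - X^p)` — the algebra of the degree-`p` step of Tate's
almost étale lemma. [cite: Tate1967, §3.2 Prop. 9] [cite: BergerColmez2008, Prop. 4.1.1] -/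
theorem minpoly_inv_gen_sub_one {p : ℕ} {α : L} {a : K} (hα : α ^ p = algebraMap K L a)
    (ha : a ≠ 1) (hgen : K⟮α⟯ = ⊤) (hfin : finrank K L = p) :
    minpoly K (α - 1)⁻¹ = (X ^ p - C (a - 1)⁻¹ * ((X + 1) ^ p - X ^ p) : K[X]) := by
  symm
  refine minpoly.unique_of_degree_le_degree_minpoly K _ (monic_invGenPoly p a)
    (aeval_invGenPoly hα ha) ?_
  have hint : IsIntegral K (α - 1)⁻¹ := .of_finite K _
  rw [degree_invGenPoly p a, degree_eq_natDegree (minpoly.ne_zero hint),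
    ← adjoin.finrank hint, adjoin_inv_sub_one_eq_top hα ha hgen, finrank_top', hfin]

/-- **`Tr_{L/K}((α - 1)⁻¹) = (a - 1)⁻¹ · p`** for `L = K(α)` of degree `p > 0` over `K`, `α ^ p = a ≠ 1`.
(Euler: `Σ_i 1/(ζ^i α - 1) = p/(a-1)` from `Π_i (X - ζ^i α) = X^p - a`.) Degree-`p` step of Tate's almost étale
lemma. [cite: Tate1967, §3.2 Prop. 9] [cite: BergerColmez2008, Prop. 4.1.1] -/
theorem trace_inv_gen_sub_one {p : ℕ} (hp : 0 < p) {α : L} {a : K} (hα : α ^ p = algebraMap K L a)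
    (ha : a ≠ 1) (hgen : K⟮α⟯ = ⊤) (hfin : finrank K L = p) :
    Algebra.trace K L (α - 1)⁻¹ = (a - 1)⁻¹ * p := by
  rw [trace_eq_finrank_mul_minpoly_nextCoeff, minpoly_inv_gen_sub_one hα ha hgen hfin,
    nextCoeff_invGenPoly hp a, neg_neg, finrank_eq_one_iff_eq_top.mpr
      (adjoin_inv_sub_one_eq_top hα ha hgen)]
  simp

/-- **`Tr_{L/K}(α (α - 1)⁻¹) = a (a - 1)⁻¹ · p`** (as `α/(α-1) = 1 + 1/(α-1)` and `Tr 1 = p`); degree-`p` step of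
Tate's almost étale lemma. [cite: Tate1967, §3.2 Prop. 9] [cite: BergerColmez2008, Prop. 4.1.1] -/
theorem trace_gen_div_gen_sub_one {p : ℕ} (hp : 0 < p) {α : L} {a : K}
    (hα : α ^ p = algebraMap K L a) (ha : a ≠ 1) (hgen : K⟮α⟯ = ⊤) (hfin : finrank K L = p) :
    Algebra.trace K L (α * (α - 1)⁻¹) = a * (a - 1)⁻¹ * p := by
  have h1 : (1 : L) = algebraMap K L 1 := (map_one _).symm
  rw [← inv_sub_one_add_one hα ha, map_add, trace_inv_gen_sub_one hp hα ha hgen hfin, h1,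
    Algebra.trace_algebraMap, hfin, nsmul_eq_mul, mul_one]
  have : (a - 1) ≠ 0 := sub_ne_zero.mpr ha
  field_simp
  ring

/-- **The explicit trace-one element** `y = ((a-1)/(p a)) · α/(α-1)` of `L = K(α)`, `[L:K] = p`,
`α ^ p = a ∉ {0, 1}`, `p ≠ 0` in `K`: **`Tr_{L/K}(y) = 1`** — the witness for `1 ∈ Tr_{L/K}(p^{-ε}𝓞_L)` in the
degree-`p` step of Tate's almost étale lemma. [cite: Tate1967, §3.2 Prop. 9] [cite: BergerColmez2008, Prop. 4.1.1] -/
theorem trace_traceOneElt {p : ℕ} (hp : 0 < p) (hpK : (p : K) ≠ 0) {α : L} {a : K}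
    (hα : α ^ p = algebraMap K L a) (ha : a ≠ 1) (ha0 : a ≠ 0) (hgen : K⟮α⟯ = ⊤)
    (hfin : finrank K L = p) :
    Algebra.trace K L (((a - 1) * (p * a)⁻¹) • (α * (α - 1)⁻¹)) = 1 := by
  rw [map_smul, trace_gen_div_gen_sub_one hp hα ha hgen hfin, smul_eq_mul]
  have : (a - 1) ≠ 0 := sub_ne_zero.mpr ha
  field_simp

end KummerTrace

/-! ### Valuation estimates in an ultrametric normed field -/

namespace KummerTrace

variable {E : Type*} [NormedField E] [IsUltrametricDist E]

/-- In an ultrametric normed field: for `p` prime and `‖β‖ ≤ 1`,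
`‖(1 + β)^p - 1 - β^p‖ ≤ ‖p‖ · ‖β‖` (the middle binomial coefficients are divisible by `p`); the `p`-th power
estimate behind Tate's computations in the cyclotomic tower. [cite: Tate1967, §3.1] [cite: BergerColmez2008, Prop. 4.1.1] -/
theorem norm_one_add_pow_sub_le {p : ℕ} (hp : p.Prime) (β : E) (hβ : ‖β‖ ≤ 1) :
    ‖(1 + β) ^ p - 1 - β ^ p‖ ≤ ‖(p : E)‖ * ‖β‖ := by
  have hexp : (1 + β) ^ p - 1 - β ^ p =
      ∑ k ∈ Finset.range (p - 1), (p.choose (k + 1) : E) * β ^ (k + 1) := by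
    obtain ⟨n, rfl⟩ : ∃ n, p = n + 2 := ⟨p - 2, (Nat.sub_add_cancel hp.two_le).symm⟩
    have h1 : n + 2 - 1 = n + 1 := rfl
    rw [h1, add_comm (1 : E) β, add_pow, Finset.sum_range_succ, Finset.sum_range_succ']
    simp only [one_pow, mul_one, pow_zero, Nat.choose_zero_right, Nat.cast_one, Nat.choose_self]
    rw [Finset.sum_congr rfl (fun k _ => mul_comm (β ^ (k + 1)) ((n + 2).choose (k + 1) : E))]
    ring
  rw [hexp]
  refine IsUltrametricDist.norm_sum_le_of_forall_le_of_nonneg (by positivity) fun k hk => ?_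
  rw [Finset.mem_range] at hk
  obtain ⟨m, hm⟩ := hp.dvd_choose_self (Nat.succ_ne_zero k) (by omega)
  rw [hm, Nat.cast_mul, norm_mul, norm_mul, norm_pow]
  have hmle : ‖(m : E)‖ ≤ 1 := IsUltrametricDist.norm_natCast_le_one E m
  have hpow : ‖β‖ ^ (k + 1) ≤ ‖β‖ := by
    calc ‖β‖ ^ (k + 1) ≤ ‖β‖ ^ 1 := pow_le_pow_of_le_one (norm_nonneg _) hβ (by omega)
      _ = ‖β‖ := pow_one _
  calc ‖(p : E)‖ * ‖(m : E)‖ * ‖β‖ ^ (k + 1) ≤ ‖(p : E)‖ * 1 * ‖β‖ := by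
        gcongr
    _ = ‖(p : E)‖ * ‖β‖ := by rw [mul_one]

/-- For `p` prime and `‖α - 1‖ ≤ 1`: **`‖α^p - 1‖ ≤ max (‖α - 1‖^p) (‖p‖ ‖α - 1‖)`**.
[cite: Tate1967, §3.1] [cite: BergerColmez2008, Prop. 4.1.1] -/
theorem norm_pow_sub_one_le {p : ℕ} (hp : p.Prime) (α : E) (hα : ‖α - 1‖ ≤ 1) :
    ‖α ^ p - 1‖ ≤ max (‖α - 1‖ ^ p) (‖(p : E)‖ * ‖α - 1‖) := by
  set β := α - 1 with hβ
  have : α ^ p - 1 = ((1 + β) ^ p - 1 - β ^ p) + β ^ p := by rw [hβ]; ring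
  rw [this]
  refine (IsUltrametricDist.norm_add_le_max _ _).trans (max_le ?_ ?_)
  · exact (norm_one_add_pow_sub_le hp β hα).trans (le_max_right _ _)
  · rw [norm_pow]; exact le_max_left _ _

/-- Consequence: for `p` prime, `‖α - 1‖ ≤ 1`, `α ^ p ≠ 1`: either `‖α^p - 1‖ ≤ ‖α-1‖^p` or
`‖α^p - 1‖ ≤ ‖p‖ ‖α-1‖`; in both cases **`‖α^p - 1‖ / (‖p‖ ‖α - 1‖) ≤ max 1 (‖α^p-1‖^((p-1)/p) / ‖p‖)`**.
Here `t = α^p - 1` and the left side is the norm of the trace-one element `t/(p(α-1))` up to units.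
[cite: Tate1967, §3.2 Prop. 9] [cite: BergerColmez2008, Prop. 4.1.1] -/
theorem norm_div_le_max {p : ℕ} (hp : p.Prime) (hpE : (p : E) ≠ 0) (α : E) (hα : ‖α - 1‖ ≤ 1)
    (ht : α ^ p ≠ 1) :
    ‖α ^ p - 1‖ / (‖(p : E)‖ * ‖α - 1‖) ≤
      max 1 (‖α ^ p - 1‖ ^ (((p : ℝ) - 1) / p) / ‖(p : E)‖) := by
  have hβ0 : α - 1 ≠ 0 := by
    intro h; apply ht; rw [sub_eq_zero.mp h, one_pow]
  have hβpos : 0 < ‖α - 1‖ := norm_pos_iff.mpr hβ0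
  have hppos : 0 < ‖(p : E)‖ := norm_pos_iff.mpr hpE
  have htpos : 0 < ‖α ^ p - 1‖ := norm_pos_iff.mpr (sub_ne_zero.mpr ht)
  have hp0 : (0 : ℝ) < p := by exact_mod_cast hp.pos
  rcases le_max_iff.mp (norm_pow_sub_one_le hp α hα) with h | h
  · -- `‖t‖ ≤ ‖β‖^p`, so `‖β‖ ≥ ‖t‖^{1/p}` and `‖t‖/‖β‖ ≤ ‖t‖^{(p-1)/p}`
    refine le_trans ?_ (le_max_right _ _)
    have hroot : ‖α ^ p - 1‖ ^ ((1 : ℝ) / p) ≤ ‖α - 1‖ := by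
      calc ‖α ^ p - 1‖ ^ ((1 : ℝ) / p) ≤ (‖α - 1‖ ^ p) ^ ((1 : ℝ) / p) :=
            Real.rpow_le_rpow (norm_nonneg _) h (by positivity)
        _ = ‖α - 1‖ := by
            rw [← Real.rpow_natCast, ← Real.rpow_mul (norm_nonneg _), mul_one_div_cancel hp0.ne',
              Real.rpow_one]
    have hab : ((p : ℝ) - 1) / p + 1 / p = 1 := by
      rw [← add_div, sub_add_cancel, div_self hp0.ne']
    calc ‖α ^ p - 1‖ / (‖(p : E)‖ * ‖α - 1‖)
        = ‖α ^ p - 1‖ ^ (((p : ℝ) - 1) / p) * ‖α ^ p - 1‖ ^ ((1 : ℝ) / p) / (‖(p : E)‖ * ‖α - 1‖) := by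
          rw [← Real.rpow_add htpos, hab, Real.rpow_one]
      _ ≤ ‖α ^ p - 1‖ ^ (((p : ℝ) - 1) / p) * ‖α - 1‖ / (‖(p : E)‖ * ‖α - 1‖) := by gcongr
      _ = ‖α ^ p - 1‖ ^ (((p : ℝ) - 1) / p) / ‖(p : E)‖ := by
          rw [mul_div_mul_right _ _ hβpos.ne']
  · -- `‖t‖ ≤ ‖p‖ ‖β‖`
    refine le_trans ?_ (le_max_left _ _)
    rwa [div_le_one (mul_pos hppos hβpos)]

/-- **Size of the explicit trace-one element.** For `p` prime, `p ≠ 0` in `E`, units `α`, `a` of norm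
`1` with `α ^ p = a ≠ 1`: `‖((a-1)(p a)⁻¹) · α (α-1)⁻¹‖ ≤ max 1 (‖a - 1‖^((p-1)/p) / ‖p‖)`. In particular if
`‖a - 1‖ ≤ ‖p‖^σ` then the trace-one element has norm `≤ max 1 ‖p‖^(σ(p-1)/p - 1)`.
[cite: Tate1967, §3.2 Prop. 9] [cite: BergerColmez2008, Prop. 4.1.1] -/
theorem norm_traceOneElt_le {p : ℕ} (hp : p.Prime) (hpE : (p : E) ≠ 0) {α a : E} (hαa : α ^ p = a)
    (hα : ‖α‖ = 1) (ha : ‖a‖ = 1) (ha1 : a ≠ 1) :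
    ‖((a - 1) * (p * a)⁻¹) * (α * (α - 1)⁻¹)‖ ≤
      max 1 (‖a - 1‖ ^ (((p : ℝ) - 1) / p) / ‖(p : E)‖) := by
  have hα1 : ‖α - 1‖ ≤ 1 := by
    rw [sub_eq_add_neg]
    refine (IsUltrametricDist.norm_add_le_max _ _).trans ?_
    rw [norm_neg, hα, norm_one, max_self]
  have ht : α ^ p ≠ 1 := by rwa [hαa]
  have key := norm_div_le_max hp hpE α hα1 ht
  rw [hαa] at key
  have hnorm : ‖((a - 1) * (p * a)⁻¹) * (α * (α - 1)⁻¹)‖ = ‖a - 1‖ / (‖(p : E)‖ * ‖α - 1‖) := by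
    rw [norm_mul, norm_mul, norm_mul, norm_inv, norm_mul, norm_inv, hα, ha]
    ring
  rwa [hnorm]

/-- Exponent form: if moreover `‖a - 1‖ ≤ ‖p‖^σ` (`σ : ℝ`) then the trace-one element has norm
`≤ max 1 (‖p‖ ^ (σ (p-1)/p - 1))`. [cite: Tate1967, §3.2 Prop. 9] [cite: BergerColmez2008, Prop. 4.1.1] -/
theorem norm_traceOneElt_le_rpow {p : ℕ} (hp : p.Prime) (hpE : (p : E) ≠ 0) {α a : E}
    (hαa : α ^ p = a) (hα : ‖α‖ = 1) (ha : ‖a‖ = 1) (ha1 : a ≠ 1) {σ : ℝ}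
    (hσ : ‖a - 1‖ ≤ ‖(p : E)‖ ^ σ) :
    ‖((a - 1) * (p * a)⁻¹) * (α * (α - 1)⁻¹)‖ ≤
      max 1 (‖(p : E)‖ ^ (σ * ((p : ℝ) - 1) / p - 1)) := by
  refine (norm_traceOneElt_le hp hpE hαa hα ha ha1).trans (max_le_max le_rfl ?_)
  have hppos : 0 < ‖(p : E)‖ := norm_pos_iff.mpr hpE
  have hp1 : (1 : ℝ) ≤ p := by exact_mod_cast hp.one_lt.le
  have hexp : 0 ≤ ((p : ℝ) - 1) / p := by
    apply div_nonneg <;> linarith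
  calc ‖a - 1‖ ^ (((p : ℝ) - 1) / p) / ‖(p : E)‖
      ≤ (‖(p : E)‖ ^ σ) ^ (((p : ℝ) - 1) / p) / ‖(p : E)‖ := by
        gcongr
    _ = ‖(p : E)‖ ^ (σ * ((p : ℝ) - 1) / p - 1) := by
        rw [← Real.rpow_mul hppos.le, Real.rpow_sub hppos, Real.rpow_one, mul_div_assoc]

end KummerTrace

end Literature.NumberTheory.PAdicHodge

end
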